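import Summits.ResolutionOfSingularities.ResolutionOfSingularities.Theorems.ValuativeLuAlphaPTorsorDiscreteAllDimExits

/-!
# `LuAlphaPTorsor` along every DISCRETE rank-one valuation, in every base dimension (assembly)

Crux `Valuative.LuAlphaPTorsor` (item `stmt-ResolutionOfSingularities-0641`), line
`pfaff-line-log-final-forms`, branch `DiscreteAllDim`, registered target
`luAlphaPTorsor_of_discrete`: for `k` of characteristic `p`, `O` a valuation ring of `K ⊇ k`
whose value group is DISCRETE OF RANK ONE (every non-zero value an integral power of the value
of one element `π ∈ 𝔪_O`), `A₀ ⊆ O` finitely generated and regular at the centre — of ANY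
dimension —, `t ^ p ∈ A₀` with `Frac (A₀[t]) = K`: some finitely generated `A ⊇ A₀[t]` inside
`O` with `Frac A = K` is regular at the centre.

This is a new TRUE range inside the open core of the crux (base dimension `≥ 3`), containing
NON-Abhyankar valuations (e.g. zero-dimensional discrete valuations = transcendental arcs on
threefolds and higher), obtained by an elementary dimension-free argument:

* the quadratic sequence `R 0 → R 1 → ⋯` of the pulled-back base inside `K₀ = Frac A₀` along
  `ν₀ = ν|K₀` (discrete of rank one by `discrete_descent`) eventually contains a generator `π`
  of the value group (`discreteAllDim_mem` — an elementary substitute for Abhyankar's union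
  lemma) and is then in the free `π`-chart regime (`div_mem_of_step`);
* at such a stage the radicand `a = t ^ p` (not a `p`-th power, `forall_ne_pow_sequence`) has a
  derivative `D a ≠ 0` (`exists_derivation_apply_ne_zero`), and the dual derivations of a
  regular system of parameters starting with `π` (`exists_rsop_cons`, `exists_dual_derivations_centre`,
  `duals_of_ringEquiv_fin`, extended to the field by `fieldDerivation_of_subring`) give a field
  derivation `D₀` killing a chart element `π'` of the same value with `D₀ a ≠ 0`
  (`discreteAllDim_initialDerivation`);
* the derivation chain `h i • D₀` (`discreteAllDim_chain`) and the approximation rounds with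
  the dimension-free slack descent (`discreteAllDim_rounds`; the schema facts "unit derivative
  or `𝔪²`" and "unit derivative or `p`-th power residue" are supplied here from dual derivations
  and residual richness `exists_derivation_isUnit_of_residue_ne_pow`) end in a monogenic or a
  toroidal exit datum on some member `R i`;
* `R i` is the local ring of a finitely generated model `A₁` (`exists_model_of_sequence_member`);
  transporting along `R i ≃ (A₁)_centre`, the landed `stub_monogenicExit` / `stub_toroidalExit`
  give the regular model. Members of dimension `≤ 1` and a base of dimension `≤ 1` are finished
  by `logPrincipalization_of_ringKrullDim_le_one` through `luAlphaPTorsor_of_ringKrullDim_le_one`;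
  a radicand which is a `p`-th power at the centre by `stub_birationalExit`.
-/

set_option linter.dupNamespace false

noncomputable section

namespace Summit.ResolutionOfSingularities.ResolutionOfSingularities.Theorems.PfaffLine

open IsLocalRing Literature.AlgebraicGeometry.Resolution DiscreteRounds DiscreteFree

/-! ## The target -/

/-- **Registered target `luAlphaPTorsor_of_discrete`: the crux `LuAlphaPTorsor` along every
DISCRETE RANK-ONE valuation, in EVERY base dimension, for every ground field of characteristic
`p`.** For `O` a valuation ring of `K ⊇ k` all of whose non-zero values are integral powers of
the value of one element `π ∈ 𝔪_O`, `A₀ ⊆ O` finitely generated and regular at the centre,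
`t ^ p ∈ A₀`, `Frac (A₀[t]) = K`: some finitely generated `A ⊇ A₀[t]` inside `O` with
`Frac A = K` is regular at the centre. See the module docstring for the proof (quadratic
sequence of the base inside `Frac A₀`, free `π`-chart regime, initial derivation, derivation
chain, approximation rounds with the dimension-free slack descent, monogenic / toroidal exits on
a finitely generated model of the exit stage). [folklore] -/
theorem luAlphaPTorsor_of_discrete :
    ∀ p : ℕ, p.Prime → ∀ (k K : Type) [Field k] [CharP k p] [Field K] [Algebra k K] (O : ValuationSubring K) (A₀ : Subalgebra k K) (h₀ : A₀.toSubring ≤ O.toSubring) (t : K), A₀.FG → t ^ p ∈ A₀ → IsFractionRing (Algebra.adjoin k (insert t (A₀ : Set K))) K → IsRegularLocalRing (Localization.AtPrime (Ideal.comap (Subring.inclusion h₀) (IsLocalRing.maximalIdeal O))) → (∃ π : K, π ≠ 0 ∧ O.valuation π < 1 ∧ ∀ z : K, z ≠ 0 → ∃ n : ℤ, O.valuation z = O.valuation π ^ n) → ∃ (A : Subalgebra k K) (h : A.toSubring ≤ O.toSubring), A₀ ≤ A ∧ t ∈ A ∧ A.FG ∧ IsFractionRing A K ∧ IsRegularLocalRing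 (Localization.AtPrime (Ideal.comap (Subring.inclusion h) (IsLocalRing.maximalIdeal O))) := by
  intro p hp k K _ _ _ _ O A₀ h₀ t hfg htp hfr hreg ⟨πK, hπK0, hπK1, hdiscK⟩
  classical
  haveI : Fact p.Prime := ⟨hp⟩
  haveI := hreg
  -- (0) the birational case: `t ^ p` a `p`-th power at the centre
  by_cases hpow : ∃ c : Localization.AtPrime (Ideal.comap (Subring.inclusion h₀)
      (maximalIdeal O)), algebraMap A₀.toSubring (Localization.AtPrime
        (Ideal.comap (Subring.inclusion h₀) (maximalIdeal O))) ⟨t ^ p, htp⟩ = c ^ p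
  · exact stub_birationalExit p hp k K O A₀ h₀ t hfg htp hfr hreg hpow
  push Not at hpow
  -- (1) base dimension `≤ 1` at the centre: no blow-up
  by_cases hdim1 : ringKrullDim (Localization.AtPrime (Ideal.comap (Subring.inclusion h₀)
      (maximalIdeal O))) ≤ 1
  · exact luAlphaPTorsor_of_ringKrullDim_le_one p hp k K O A₀ h₀ t hfg htp hfr hreg hdim1
  -- (2) the subfield `K₀ = Frac A₀`, the pulled-back valuation ring and base, its local ring
  set K₀ : Subfield K := Subfield.closure (A₀ : Set K)
  set ι : K₀ →+* K := K₀.subtype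
  have hιrange : ∀ x : K, x ∈ ι.range ↔ x ∈ K₀ := fun x =>
    ⟨fun ⟨y, hy⟩ => hy ▸ y.2, fun hx => ⟨⟨x, hx⟩, rfl⟩⟩
  have hA₀range : A₀.toSubring ≤ ι.range := fun x hx =>
    (hιrange x).mpr (Subfield.subset_closure hx)
  have hclos : Subring.closure (A₀ : Set K) = A₀.toSubring := by
    rw [← Subalgebra.coe_toSubring, Subring.closure_eq]
  have hfracK₀ : ∀ z : K₀, ∃ a ∈ A₀.toSubring, ∃ c ∈ A₀.toSubring, ι z = a / c := by
    intro z
    obtain ⟨y, hy, w, hw, hz⟩ := Subfield.mem_closure_iff.mp z.2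
    rw [hclos] at hy hw
    exact ⟨y, hy, w, hw, hz.symm⟩
  set O' : ValuationSubring K₀ := O.comap ι
  set A₀' : Subring K₀ := A₀.toSubring.comap ι
  have h₀' : A₀' ≤ O'.toSubring := comap_le_comap_valuationSubring ι h₀
  set R₀ : Subring K₀ := locAtCentre A₀' O'
  have hR0' : (locAtCentre A₀.toSubring O).comap ι = R₀ := comap_locAtCentre ι O hA₀range
  obtain ⟨e₀, he₀⟩ := exists_ringEquiv_atPrime ι O A₀.toSubring h₀ hA₀range hR0'
  have hreg₀ : IsRegularLocalRing R₀ := IsRegularLocalRing.of_ringEquiv e₀.symm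
  have hof₀ : IsLocalRingOf R₀ := by
    refine ⟨isLocalRing_locAtCentre h₀', fun z => ?_⟩
    rw [← hR0']
    refine exists_div_eq_of_comap ι (fun z => ?_) (locAtCentre_le_range ι O hA₀range) z
    obtain ⟨a, ha, c, hc, hz⟩ := hfracK₀ z
    exact ⟨a, le_locAtCentre _ O ha, c, le_locAtCentre _ O hc, hz⟩
  have hdom₀ : SubringDominates R₀ O'.toSubring := subringDominates_locAtCentre h₀'
  have hnf : ¬ IsField R₀ := by
    refine not_isField_of_ringKrullDim_ne_zero (R := R₀) fun h0 => hdim1 ?_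
    rw [← ringKrullDim_eq_of_ringEquiv e₀, h0]
    exact zero_le_one
  -- (3) the quadratic sequence along `O'`: members regular, dominated, fractions, models
  have hstep := isQuadraticTransformAlong_quadraticSeq_of_isRegularLocalRing hreg₀ hnf hdom₀
  set R : ℕ → Subring K₀ := quadraticSeq O' R₀
  have hR0 : R 0 = R₀ := rfl
  have hregj : ∀ j, IsRegularLocalRing (R j) := isRegularLocalRing_sequence hreg₀ hstep
  have hRO : ∀ n, SubringDominates (R n) O'.toSubring := fun n => (sequence_dominates hdom₀ hstep n).1
  have hmono : Monotone R := sequence_monotone hstep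
  have hfrac : ∀ (n : ℕ) (z : K₀), ∃ a ∈ R n, ∃ b ∈ R n, b ≠ 0 ∧ z = a / b := by
    intro n z
    obtain ⟨a, ha, b, hb, hb0, hz⟩ := hof₀.2 z
    exact ⟨a, hmono (Nat.zero_le n) ha, b, hmono (Nat.zero_le n) hb, hb0, hz⟩
  have hsch := fun n => sequence_schema_of_ringHom p ι O A₀ h₀ hfg hreg hA₀range hR0 hstep n
  have hdualn : ∀ (n d : ℕ) (v : Fin d → R n), ringKrullDim (R n) = (d : WithBot ℕ∞) →
      (∀ z : R n, z ∈ Ideal.span (Set.range v) ↔ ¬ IsUnit z) →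
        ∃ D : Fin d → Derivation ℤ (R n) (R n), ∀ l j, D l (v j) = if l = j then 1 else 0 := by
    intro n d v hdimn hv
    obtain ⟨A₁, h₁, -, hfg₁, -, -, e, -⟩ :=
      exists_model_of_sequence_member k K K₀ ι O A₀ h₀ hfg hA₀range R hR0 hstep n
    haveI := hregj n
    have hregL : IsRegularLocalRing
        (Localization.AtPrime (Ideal.comap (Subring.inclusion h₁) (maximalIdeal O))) :=
      IsRegularLocalRing.of_ringEquiv e
    have hdimL : ringKrullDim
        (Localization.AtPrime (Ideal.comap (Subring.inclusion h₁) (maximalIdeal O))) =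
          (d : WithBot ℕ∞) := by
      rw [← ringKrullDim_eq_of_ringEquiv e]; exact hdimn
    refine duals_of_ringEquiv_fin e d (fun v' hv' => ?_) v hv
    exact exists_dual_derivations_centre p k K O A₁ h₁ hfg₁ hregL v'
      (forall_mem_iff_not_isUnit_iff_mainInductionDim.mp hv') hdimL
  -- (4) the radicand `a = t ^ p` in `R 0`, not a `p`-th power in any member
  have htpK₀ : t ^ p ∈ K₀ := Subfield.subset_closure htp
  have htpA₀' : (⟨t ^ p, htpK₀⟩ : K₀) ∈ A₀' := htp
  set f₀ : R 0 := ⟨⟨t ^ p, htpK₀⟩, le_locAtCentre A₀' O' htpA₀'⟩ with hf₀_def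
  have hf₀K : ((f₀ : R 0) : K₀) = ⟨t ^ p, htpK₀⟩ := rfl
  have he₀f : e₀ f₀ = algebraMap A₀.toSubring (Localization.AtPrime (Ideal.comap
      (Subring.inclusion h₀) (maximalIdeal O))) ⟨t ^ p, htp⟩ := he₀ f₀ htp
  have hfne : ∀ c : R 0, f₀ ≠ c ^ p := by
    intro c hc
    apply hpow (e₀ c)
    rw [← he₀f, hc]
    exact map_pow e₀ c p
  have hane : ∀ j, ∀ c : R j, Subring.inclusion (hmono (Nat.zero_le j)) f₀ ≠ c ^ p := fun j =>
    forall_ne_pow_sequence O' R hreg₀ hstep p f₀ hfne j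
  set aK : K₀ := (f₀ : K₀) with haK_def
  have hap : ∀ j, ∀ c : K₀, c ∈ R j → aK ≠ c ^ p := by
    intro j c hc h
    refine hane j ⟨c, hc⟩ (Subtype.ext ?_)
    rw [Subring.coe_inclusion, Subring.coe_pow]
    exact h
  have haR : ∀ j, aK ∈ R j := fun j => hmono (Nat.zero_le j) f₀.2
  -- (5) the value group of `O'` on `K₀` is discrete of rank one
  obtain ⟨m₀, hm₀R, hm₀0, hm₀1⟩ : ∃ m : K₀, m ∈ R 0 ∧ m ≠ 0 ∧ O'.valuation m < 1 := by
    haveI := hregj 0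
    have hne : maximalIdeal (R 0) ≠ ⊥ := fun hbot =>
      hnf ((IsLocalRing.isField_iff_maximalIdeal_eq).mpr hbot)
    obtain ⟨z, hz, hz0⟩ := Submodule.exists_mem_ne_zero_of_ne_bot hne
    refine ⟨z, z.2, fun e => hz0 (Subtype.ext e), ?_⟩
    exact ((subringDominates_valuationSubring_iff (hRO 0).1).mp (hRO 0) z).mp hz
  obtain ⟨π₀, hπ₀0, hπ₀1, hdisc₀⟩ := discrete_descent ι O hπK0 hπK1 hdiscK hm₀0 hm₀1
  have hγ₀ : O'.valuation π₀ ≠ 0 := (Valuation.ne_zero_iff _).mpr hπ₀0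
  have hmax₀ : ∀ z : K₀, O'.valuation z < 1 → O'.valuation z ≤ O'.valuation π₀ := fun z hz =>
    valuation_le_of_lt_one hπ₀1 hγ₀ hdisc₀ hz
  -- (6) a generator of the value group lies in some member `R i₁` (L1); the free chart regime
  obtain ⟨i₁, hπ₀R⟩ := discreteAllDim_mem K₀ O' R π₀ hof₀ hdom₀ hstep hπ₀1 hdisc₀
  have hfreeOf : ∀ ϖ : K₀, ϖ ∈ R i₁ → O'.valuation ϖ = O'.valuation π₀ → ∀ i : ℕ, i₁ ≤ i →
      ϖ ∈ R i ∧ ∀ z : K₀, z ∈ R i → z⁻¹ ∉ R i → z / ϖ ∈ R (i + 1) := by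
    intro ϖ hϖR hvϖ i hi
    have hϖi : ϖ ∈ R i := hmono hi hϖR
    refine ⟨hϖi, fun z hz hzi => ?_⟩
    refine div_mem_of_step (hstep i) (hRO i) hϖi (by rw [hvϖ]; exact hπ₀1)
      (by rw [hvϖ]; exact hγ₀) (fun w hw => ?_) hz hzi
    rw [hvϖ]; exact hmax₀ w hw
  -- (7) the stage `i₁`: dimension `≤ 1` is finished on a model; else dimension `≥ 2`
  haveI := hregj i₁
  by_cases hd1 : ringKrullDim (R i₁) ≤ 1
  · obtain ⟨A₁, h₁, hle, hfg₁, -, -, e, -⟩ :=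
      exists_model_of_sequence_member k K K₀ ι O A₀ h₀ hfg hA₀range R hR0 hstep i₁
    have hreg₁ : IsRegularLocalRing
        (Localization.AtPrime (Ideal.comap (Subring.inclusion h₁) (maximalIdeal O))) :=
      IsRegularLocalRing.of_ringEquiv e
    have hdim₁ : ringKrullDim
        (Localization.AtPrime (Ideal.comap (Subring.inclusion h₁) (maximalIdeal O))) ≤ 1 := by
      rw [← ringKrullDim_eq_of_ringEquiv e]; exact hd1
    have hfr₁ : IsFractionRing (Algebra.adjoin k (insert t (A₁ : Set K))) K :=
      isFractionRing_of_le (adjoin_insert_mono' hle t) hfr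
    obtain ⟨A, h, hle₁, ht, hAfg, hAfr, hAreg⟩ :=
      luAlphaPTorsor_of_ringKrullDim_le_one p hp k K O A₁ h₁ t hfg₁ (hle htp) hfr₁ hreg₁ hdim₁
    exact ⟨A, h, hle.trans hle₁, ht, hAfg, hAfr, hAreg⟩
  -- the regular system of parameters starting with `π₀`, its dual field derivations
  have hπ₀m : (⟨π₀, hπ₀R⟩ : R i₁) ∈ maximalIdeal (R i₁) :=
    (mem_maximalIdeal_iff_inv_not_mem _).mpr
      (Or.inr (inv_not_mem_subring_of_valuation_lt_one (hRO i₁).1 hπ₀0 hπ₀1))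
  have hπ₀sq : (⟨π₀, hπ₀R⟩ : R i₁) ∉ maximalIdeal (R i₁) ^ 2 :=
    not_mem_sq_of_valuation_eq_dad (hRO i₁) hπ₀0 hπ₀1 hmax₀ rfl
  obtain ⟨d, u, hu0, huspan, hdimu⟩ := exists_rsop_cons (L := R i₁) ⟨π₀, hπ₀R⟩ hπ₀m hπ₀sq
  obtain ⟨d', rfl⟩ : ∃ d', d = d' + 1 := by
    refine ⟨d - 1, ?_⟩
    rcases Nat.eq_zero_or_pos d with rfl | hdpos
    · exfalso
      apply hd1
      rw [hdimu]
      exact_mod_cast (le_refl 1)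
    · omega
  have hu' : ∀ z : R i₁, z ∈ Ideal.span (Set.range u) ↔ ¬ IsUnit z := fun z => by
    rw [huspan, IsLocalRing.mem_maximalIdeal, mem_nonunits_iff]
  obtain ⟨Dsub, hDsub⟩ := hdualn i₁ (d' + 1 + 1) u hdimu hu'
  have hDu := fun l => fieldDerivation_of_subring K₀ (R i₁) (hfrac i₁) (Dsub l)
  choose Du hDu using hDu
  -- a derivation seeing the radicand (non-`p`-th powers are detected by derivations)
  obtain ⟨m₁, 𝔮₁, h𝔮₁, Φq₁, hΦq₁⟩ := (hsch i₁).2.2.2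
  haveI := h𝔮₁
  obtain ⟨δa, hδa⟩ := exists_derivation_apply_ne_zero hp 𝔮₁ Φq₁ hΦq₁ (hane i₁)
  obtain ⟨Df, hDf⟩ := fieldDerivation_of_subring K₀ (R i₁) (hfrac i₁) δa
  have hDfa : Df aK ≠ 0 := by
    have e1 : Df aK = δa (Subring.inclusion (hmono (Nat.zero_le i₁)) f₀) :=
      hDf (Subring.inclusion (hmono (Nat.zero_le i₁)) f₀)
    rw [e1]
    exact fun h0 => hδa (Subtype.ext h0)
  -- characteristic bookkeeping: `K₀` has characteristic `p`, so `M ∈ {2, 3}` is non-zero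
  have hA₀K₀ : A₀.toSubring ≤ K₀.toSubring := fun x hx => Subfield.subset_closure hx
  haveI : CharP K₀ p := by
    have f : k →+* K₀ := (Subring.inclusion hA₀K₀).comp (algebraMap k A₀ : k →+* A₀.toSubring)
    exact charP_of_injective_ringHom f.injective p
  obtain ⟨M, hM2, hMK⟩ : ∃ M : ℕ, 2 ≤ M ∧ (M : K₀) ≠ 0 := by
    by_cases hp2 : p = 2
    · refine ⟨3, by norm_num, fun h3 => ?_⟩
      have := (CharP.cast_eq_zero_iff K₀ p 3).mp (by exact_mod_cast h3)
      rw [hp2] at this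
      omega
    · refine ⟨2, le_rfl, fun h2 => hp2 ?_⟩
      have := (CharP.cast_eq_zero_iff K₀ p 2).mp (by exact_mod_cast h2)
      exact (Nat.prime_dvd_prime_iff_eq hp Nat.prime_two).mp this
  -- (8) the initial derivation (L2): a chart element `π'` of the same value, `D₀ π' = 0`
  obtain ⟨π', D₀, hπ'R, hvπ', hD₀π', hD₀R, hD₀a⟩ :=
    discreteAllDim_initialDerivation K₀ O' (R i₁) π₀ aK d' M (fun j => ((u j : R i₁) : K₀)) Du Df
      (hRO i₁) hπ₀1 hmax₀ (by rw [hu0]) (fun j => ⟨(u j).2,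
        valuation_lt_one_of_not_isUnit_dad (hRO i₁) ((hu' (u j)).mp (Ideal.subset_span ⟨j, rfl⟩))⟩)
      (fun l j => by rw [hDu l (u j), hDsub l j]; split_ifs <;> rfl)
      (fun l z hz => by rw [hDu l ⟨z, hz⟩]; exact (Dsub l ⟨z, hz⟩).2)
      (fun z hz => by rw [hDf ⟨z, hz⟩]; exact (δa ⟨z, hz⟩).2) (haR i₁) hDfa hM2 hMK
  have hπ'0 : π' ≠ 0 := fun h0 => hγ₀ (by rw [← hvπ', h0, map_zero])
  have hπ'1 : O'.valuation π' < 1 := by rw [hvπ']; exact hπ₀1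
  have hdisc' : ∀ z : K₀, z ≠ 0 → ∃ n : ℤ, O'.valuation z = O'.valuation π' ^ n := by
    intro z hz; rw [hvπ']; exact hdisc₀ z hz
  have hfree' := hfreeOf π' hπ'R hvπ'
  -- (9) the derivation chain (L3) and the rounds (L4)
  obtain ⟨h, -, hchain⟩ := discreteAllDim_chain K₀ O' R π' i₁ D₀ hdom₀ hstep hπ'0 hπ'1 hfree' hD₀π' hD₀R
  have hsq : ∀ i : ℕ, i₁ ≤ i → ∀ f : K₀, f ∈ R i → O'.valuation f < 1 →
      (∃ δ : Derivation ℤ K₀ K₀, (∀ z : K₀, z ∈ R i → δ z ∈ R i) ∧ δ f ≠ 0 ∧ (δ f)⁻¹ ∈ R i) ∨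
      (∃ (m : ℕ) (b c : Fin m → K₀), (∀ l, b l ∈ R i ∧ O'.valuation (b l) < 1 ∧ c l ∈ R i ∧
        O'.valuation (c l) < 1) ∧ f = Finset.univ.sum fun l => b l * c l) := by
    intro i _ f hf hvf
    haveI := hregj i
    exact sq_or_unit_derivative_dad O' (R i) (hRO i) (hfrac i) (hdualn i) f hf hvf
  have hres : ∀ i : ℕ, i₁ ≤ i → ∀ w : K₀, w ∈ R i → w⁻¹ ∈ R i →
      (∃ δ : Derivation ℤ K₀ K₀, (∀ z : K₀, z ∈ R i → δ z ∈ R i) ∧ δ w ≠ 0 ∧ (δ w)⁻¹ ∈ R i) ∨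
      (∃ e : K₀, e ∈ R i ∧ O'.valuation (w - e ^ p) < 1) := by
    intro i _ w hw _
    haveI := hregj i
    obtain ⟨m, 𝔮, h𝔮, Φq, hsurj⟩ := (hsch i).2.2.2
    haveI := h𝔮
    exact res_or_unit_derivative_dad O' (R i) hp (hRO i) (hfrac i) 𝔮 Φq hsurj w hw
  obtain ⟨i, hi, c, hc, hexit⟩ := discreteAllDim_rounds p K₀ O' R π' i₁ D₀ h aK hdom₀ hstep hπ'0
    hπ'1 hdisc' hfree' hD₀π' hchain hsq hres (haR i₁) (fun i _ c hc => hap i c hc) hD₀a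
  -- (10) the exits on a finitely generated model of the stage `i`
  set ai : R i := Subring.inclusion (hmono (Nat.zero_le i)) f₀ with hai_def
  have haiK : ((ai : R i) : K₀) = aK := rfl
  haveI := hregj i
  refine exit_of_datum_dad p hp k K K₀ ι O A₀ h₀ t hfg htp hfr hA₀range R hR0 hstep i ai rfl c hc ?_
  rcases hexit with ⟨g, b, δ, hg, hb, hg0, hδR, hδb0, hδbi, heq⟩ | ⟨w, N, hw, hwi, hpN, heq⟩
  · exact Or.inl ⟨g, b, δ, hg, hb, hg0, hδR, hδb0, hδbi, by rw [haiK]; exact heq⟩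
  · have hw0 : w ≠ 0 := by
      rintro rfl
      rw [mul_zero, sub_eq_zero] at heq
      exact hap i c hc heq
    have hπ'i : π' ∈ R i := (hfree' i hi).1
    have hmax' : ∀ z : K₀, O'.valuation z < 1 → O'.valuation z ≤ O'.valuation π' := fun z hz => by
      rw [hvπ']; exact hmax₀ z hz
    have hπ'm : (⟨π', hπ'i⟩ : R i) ∈ maximalIdeal (R i) :=
      (mem_maximalIdeal_iff_inv_not_mem _).mpr
        (Or.inr (inv_not_mem_subring_of_valuation_lt_one (hRO i).1 hπ'0 hπ'1))
    have hπ'sq : (⟨π', hπ'i⟩ : R i) ∉ maximalIdeal (R i) ^ 2 :=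
      not_mem_sq_of_valuation_eq_dad (hRO i) hπ'0 hπ'1 hmax' rfl
    exact Or.inr ⟨π', w, N, hπ'i, hw, hwi, hw0, hpN, hπ'm, hπ'sq, by rw [haiK]; exact heq⟩

end Summit.ResolutionOfSingularities.ResolutionOfSingularities.Theorems.PfaffLine

end
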